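import Summits.KontsevichZagierPeriods.KontsevichZagierPeriods.Theorems.ReductionTwoSix.Negative.Kit

/-!
# `ReductionTwoSix` (stmt-KontsevichZagierPeriods-3871) — negative side III: tightness of the normal form

Refuter (`cdisprove`) results, kernel-checked, all by the soundness channel and conditional on
`RigidityInput I₁ I₂` (the route's own standing hypotheses, `Negative.Kit`):
* none of the three basis functions `1, 1/(1−xy), 1/(1+xy+x²y²)` of the normal form can be dropped
  (`not_reductionTwoSixNoConst/NoPole/NoCubic`; witnesses `P = 1−t⁶, 1+t+…+t⁵, 1−t+t³−t⁴`, whose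
  sector integrands ARE the basis functions) — in particular KZ's own `ζ(2)`-normal form
  `a + b/(1−xy)` is too small at level 6, which is exactly where CDT's `L(2,χ₋₃)` enters;
* integer coefficients do not suffice (`not_reductionTwoSixInt`, `P = ½(1−t⁶)`), although the group
  of moves is only ℤ-linear (the rational scalars ride inside integrands, cf. `Negative.Bookkeeping`);
* the TRUE strengthening, uniqueness of `(a,b,c)`, is `normalForm_unique` (not refutable).
[Kontsevich–Zagier 2001 §1.2; Calegari–Dimitrov–Tang 2024 Thm 1]
-/

namespace Summit.KontsevichZagierPeriods.HurwitzMicroSectors.ReductionTwoSixNegative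

open MeasureTheory Set
open Literature.NumberTheory.Transcendental
open Summit.KontsevichZagierPeriods.KontsevichZagierPeriods.Theses.HurwitzMicroSectors

noncomputable section

variable {I₁ I₂ : ℝ}

/-! ## §3 Witness representations inside the crux's hypothesis class

Three members of the sector `P(t)/(1−t⁶)` ARE normal forms (so the crux holds for them by `refl`):
`P = q(1−t⁶)` (constant `q`), `P = 1+t+…+t⁵` (`1/(1−t)`), `P = 1−t+t³−t⁴` (`1/(1+t+t²)`). -/

open Polynomial in
/-- `P = C q · (1 − X⁶)`: integrand `q`. -/
theorem eqOn_const_witness (q : ℚ) :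
    EqOn (nf q 0 0) (fun x : Fin 2 → ℝ =>
      Polynomial.aeval (x 0 * x 1) (C q * (1 - X ^ 6)) / (1 - (x 0 * x 1) ^ 6)) box := by
  intro x hx
  have h6 := one_sub_t6_ne hx
  simp only [nf, Rat.cast_zero, zero_div, add_zero]
  generalize x 0 * x 1 = t at h6 ⊢
  simp only [map_mul, map_sub, map_one, map_pow, Polynomial.aeval_C, Polynomial.aeval_X,
    eq_ratCast]
  rw [mul_div_assoc, div_self h6, mul_one]

open Polynomial in
/-- `P = 1 + X + X² + X³ + X⁴ + X⁵`: integrand `1/(1−t)`. -/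
theorem eqOn_pole_witness :
    EqOn (nf 0 1 0) (fun x : Fin 2 → ℝ =>
      Polynomial.aeval (x 0 * x 1) (1 + X + X ^ 2 + X ^ 3 + X ^ 4 + X ^ 5 : ℚ[X]) /
        (1 - (x 0 * x 1) ^ 6)) box := by
  intro x hx
  have h6 := one_sub_t6_ne hx
  have h1 := one_sub_t_ne hx
  simp only [nf, map_add, map_one, map_pow, Polynomial.aeval_X, Rat.cast_zero, Rat.cast_one,
    zero_div, add_zero, zero_add]
  generalize x 0 * x 1 = t at h1 h6 ⊢
  rw [div_eq_div_iff h1 h6]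
  ring

open Polynomial in
/-- `P = 1 − X + X³ − X⁴`: integrand `1/(1+t+t²)` (since `(1−t+t³−t⁴)(1+t+t²) = 1 − t⁶`). -/
theorem eqOn_cubic_witness :
    EqOn (nf 0 0 1) (fun x : Fin 2 → ℝ =>
      Polynomial.aeval (x 0 * x 1) (1 - X + X ^ 3 - X ^ 4 : ℚ[X]) / (1 - (x 0 * x 1) ^ 6)) box := by
  intro x hx
  have h6 := one_sub_t6_ne hx
  have h2 := cubic_ne hx
  simp only [nf, map_add, map_sub, map_one, map_pow, Polynomial.aeval_X, Rat.cast_zero,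
    Rat.cast_one, zero_div, add_zero, zero_add]
  generalize x 0 * x 1 = t at h2 h6 ⊢
  rw [div_eq_div_iff h2 h6]
  ring

/-! ## §4 Refuted variants (all by the soundness channel, conditional on `RigidityInput`)

Each `def` below is the crux `ReductionTwoSix` with ONE change; each is FALSE under the route's
standing hypotheses. They delimit the statement: the normal form is minimal (no basis function can
be dropped: TIGHTNESS) and its coefficients are genuinely rational (the ℤ-linear group of moves must
carry the rational scalars INSIDE integrands — which `bookkeeping` shows it can). -/

/-- Variant: integer coefficients `a b c : ℤ` in the normal form. -/
def ReductionTwoSixInt : Prop :=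
  ∀ (r : KZ.IntegralRep 2) (P : Polynomial ℚ), r.domain = {x | ∀ i, x i ∈ Set.Ioo (0:ℝ) 1} →
    Set.EqOn r.integrand (fun x => Polynomial.aeval (x 0 * x 1) P / (1 - (x 0 * x 1) ^ 6)) r.domain →
    ∃ (a b c : ℤ) (r' : KZ.IntegralRep 2), r'.domain = {x | ∀ i, x i ∈ Set.Ioo (0:ℝ) 1} ∧
      Set.EqOn r'.integrand
        (fun x => (a : ℝ) + b / (1 - x 0 * x 1) + c / (1 + x 0 * x 1 + (x 0 * x 1) ^ 2)) r'.domain ∧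
      KZ.Equivalent r r'

/-- Variant (tightness): no constant term, normal form `b/(1−xy) + c/(1+xy+x²y²)`. -/
def ReductionTwoSixNoConst : Prop :=
  ∀ (r : KZ.IntegralRep 2) (P : Polynomial ℚ), r.domain = {x | ∀ i, x i ∈ Set.Ioo (0:ℝ) 1} →
    Set.EqOn r.integrand (fun x => Polynomial.aeval (x 0 * x 1) P / (1 - (x 0 * x 1) ^ 6)) r.domain →
    ∃ (b c : ℚ) (r' : KZ.IntegralRep 2), r'.domain = {x | ∀ i, x i ∈ Set.Ioo (0:ℝ) 1} ∧
      Set.EqOn r'.integrand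
        (fun x => (b : ℝ) / (1 - x 0 * x 1) + c / (1 + x 0 * x 1 + (x 0 * x 1) ^ 2)) r'.domain ∧
      KZ.Equivalent r r'

/-- Variant (tightness): no `1/(1−xy)` term, normal form `a + c/(1+xy+x²y²)`. -/
def ReductionTwoSixNoPole : Prop :=
  ∀ (r : KZ.IntegralRep 2) (P : Polynomial ℚ), r.domain = {x | ∀ i, x i ∈ Set.Ioo (0:ℝ) 1} →
    Set.EqOn r.integrand (fun x => Polynomial.aeval (x 0 * x 1) P / (1 - (x 0 * x 1) ^ 6)) r.domain →
    ∃ (a c : ℚ) (r' : KZ.IntegralRep 2), r'.domain = {x | ∀ i, x i ∈ Set.Ioo (0:ℝ) 1} ∧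
      Set.EqOn r'.integrand
        (fun x => (a : ℝ) + c / (1 + x 0 * x 1 + (x 0 * x 1) ^ 2)) r'.domain ∧
      KZ.Equivalent r r'

/-- Variant (tightness): no `1/(1+xy+x²y²)` term, normal form `a + b/(1−xy)` (the "ζ(2)-only"
normal form KZ's own example would suggest). -/
def ReductionTwoSixNoCubic : Prop :=
  ∀ (r : KZ.IntegralRep 2) (P : Polynomial ℚ), r.domain = {x | ∀ i, x i ∈ Set.Ioo (0:ℝ) 1} →
    Set.EqOn r.integrand (fun x => Polynomial.aeval (x 0 * x 1) P / (1 - (x 0 * x 1) ^ 6)) r.domain →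
    ∃ (a b : ℚ) (r' : KZ.IntegralRep 2), r'.domain = {x | ∀ i, x i ∈ Set.Ioo (0:ℝ) 1} ∧
      Set.EqOn r'.integrand (fun x => (a : ℝ) + b / (1 - x 0 * x 1)) r'.domain ∧
      KZ.Equivalent r r'

/-- ℤ-coefficients do NOT suffice: the member `P = ½(1−t⁶)` (integrand `½`) has the unique normal
form `(½, 0, 0)`. -/
theorem not_reductionTwoSixInt (h : RigidityInput I₁ I₂) : ¬ ReductionTwoSixInt := by
  intro H
  obtain ⟨a, b, c, r', hdom', hint', heqv⟩ :=
    H (nfRep h (1/2) 0 0) (Polynomial.C (1/2 : ℚ) * (1 - Polynomial.X ^ 6)) rfl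
      (eqOn_const_witness (1/2))
  have hint'' : EqOn r'.integrand (nf (a : ℚ) (b : ℚ) (c : ℚ)) box := by
    intro x hx
    rw [hint' (hdom' ▸ hx : x ∈ r'.domain)]
    simp [nf]
  obtain ⟨ha, -, -⟩ := coeff_eq_of_equivalent h _ r' rfl (fun _ _ => rfl) hdom' hint'' heqv
  have h2 : (2 : ℚ) * (a : ℚ) = 1 := by rw [← ha]; norm_num
  have h3 : (2 : ℤ) * a = 1 := by exact_mod_cast h2
  omega

/-- TIGHTNESS: the constant cannot be dropped (`P = 1 − t⁶`, value `1 ∉ ℚI₁ + ℚI₂`). -/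
theorem not_reductionTwoSixNoConst (h : RigidityInput I₁ I₂) : ¬ ReductionTwoSixNoConst := by
  intro H
  obtain ⟨b, c, r', hdom', hint', heqv⟩ :=
    H (nfRep h 1 0 0) (Polynomial.C (1 : ℚ) * (1 - Polynomial.X ^ 6)) rfl (eqOn_const_witness 1)
  have hint'' : EqOn r'.integrand (nf 0 b c) box := by
    intro x hx
    rw [hint' (hdom' ▸ hx : x ∈ r'.domain)]
    simp [nf]
  obtain ⟨ha, -, -⟩ := coeff_eq_of_equivalent h _ r' rfl (fun _ _ => rfl) hdom' hint'' heqv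
  exact one_ne_zero ha

/-- TIGHTNESS: the `1/(1−xy)` term cannot be dropped (`P = 1+t+…+t⁵`, value `I₁ = π²/6`). -/
theorem not_reductionTwoSixNoPole (h : RigidityInput I₁ I₂) : ¬ ReductionTwoSixNoPole := by
  intro H
  obtain ⟨a, c, r', hdom', hint', heqv⟩ :=
    H (nfRep h 0 1 0) _ rfl eqOn_pole_witness
  have hint'' : EqOn r'.integrand (nf a 0 c) box := by
    intro x hx
    rw [hint' (hdom' ▸ hx : x ∈ r'.domain)]
    simp [nf]
  obtain ⟨-, hb, -⟩ := coeff_eq_of_equivalent h _ r' rfl (fun _ _ => rfl) hdom' hint'' heqv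
  exact one_ne_zero hb

/-- TIGHTNESS: the `1/(1+xy+x²y²)` term cannot be dropped (`P = 1−t+t³−t⁴`, value `I₂ = L(2,χ₋₃)`):
KZ's `ζ(2)`-only normal form is too small for level 6 — this is exactly where CDT 2024 enters. -/
theorem not_reductionTwoSixNoCubic (h : RigidityInput I₁ I₂) : ¬ ReductionTwoSixNoCubic := by
  intro H
  obtain ⟨a, b, r', hdom', hint', heqv⟩ :=
    H (nfRep h 0 0 1) _ rfl eqOn_cubic_witness
  have hint'' : EqOn r'.integrand (nf a b 0) box := by
    intro x hx
    rw [hint' (hdom' ▸ hx : x ∈ r'.domain)]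
    simp [nf]
  obtain ⟨-, -, hc⟩ := coeff_eq_of_equivalent h _ r' rfl (fun _ _ => rfl) hdom' hint'' heqv
  exact one_ne_zero hc

/-- STRENGTHENING THAT STAYS TRUE (uniqueness half, = item `RigidityTwoSix` abstracted): whatever
normal form the crux produces, its coefficients are pinned by the value. Not refutable. -/
theorem normalForm_unique (h : RigidityInput I₁ I₂) (r : KZ.IntegralRep 2) {a b c a' b' c' : ℚ}
    (r₁ r₂ : KZ.IntegralRep 2) (h₁ : r₁.domain = box) (h₁' : EqOn r₁.integrand (nf a b c) box)
    (h₂ : r₂.domain = box) (h₂' : EqOn r₂.integrand (nf a' b' c') box)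
    (e₁ : KZ.Equivalent r r₁) (e₂ : KZ.Equivalent r r₂) : a = a' ∧ b = b' ∧ c = c' :=
  coeff_eq_of_equivalent h r₁ r₂ h₁ h₁' h₂ h₂' (e₁.symm.trans e₂)

end

end Summit.KontsevichZagierPeriods.HurwitzMicroSectors.ReductionTwoSixNegative
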